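import Mathlib
import Summits.NavierStokesRegularity.FluidComputer.AbcClassIIBasesPrep

/-!
# Class-II layer of the skew-cut X0 chain, Part A2′: the end-to-end theorem in ARBITRARY orbit bases
(instab4 g7 — implementation 2 of the skew-cut X0 certifier, cell `ns-blowup`, 2026-08-27)

HONEST FRAMING (human ruling D-0035): nothing here is a claim about Navier–Stokes blow-up.
WHAT THIS IS NOT: not NS evidence. MODEL lane (Navier–Stokes linearised about the forced ABC flow
`U = abcFlow 1 1 1`, `f = νU`); no certificate, number or census word moves.

`AbcClassIISections.isLinNSEigenvalue_of_certificate` (instab4 g6) takes its three hypotheses — (T1)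
opposite signs of the two HEAD determinants on `cubeIdx K`, (T2) the SHELL numbers `μ_i > 0` in the
Schur form `Λ − √2 − C A⁻¹ B` on `cubeIdx (K+1) ∖ cubeIdx K`, (T3) the TAIL constants — about the real
Galerkin matrices `[(x + |O|²/R)δ − amat]` in the EXISTENTIAL orbit basis `bfam`. Here the same
theorem is proved with `amat` replaced by the first-order matrix
`am i j = Re Σ_{k ∈ O_i} ⟪bf i k, Π_k X(bf j)(k)⟫` of the basis families `bf i = extend O_i (e O_i i.2)`
of an ARBITRARY family `e O` of real orthonormal bases of the class-II orbit spaces `realSpace O`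
(indexed by `Fin (odim O)`): **`isLinNSEigenvalue_of_certificate_of_bases`**. This is the statement a
CERTIFIER AUDIT can discharge in the certifier's OWN basis: what it must check of that basis is exactly
«for every orbit `O` of the cube `K+1`: the certifier's vectors on `O` are transversal, class II,
conjugate-symmetric (i.e. lie in `realSpace O`), real-orthonormal, and there are `odim O` of them».

Proof (change of orthonormal basis, blockwise per orbit): with the real coefficient kernel
`Q i j = Re Σ_k ⟪bfam i k, bf j k⟫` (zero across orbits; on each orbit the orthogonal change-of-basis
matrix — `AbcClassIIBasesPrep`), on every orbit-saturated index set `T` the matrix `Q_T = (Q i j)_{T×T}`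
is orthogonal and `S'_T(x) = Q_Tᵀ S_T(x) Q_T` (§1; the levels `|O|²/R` are constant on orbits, so the
diagonal part commutes with `Q`); head × shell blocks transform alike (§1, disjoint case); hence
`det S'_H = (det Q_H)² det S_H` — (T1) is invariant (§2) — and
`C' A'⁻¹ B' = Q_sᵀ (C A⁻¹ B) Q_s`, `Λ Q_sᵀ = Q_sᵀ Λ` — (T2) is invariant under `w ↦ Q_sᵀ w` (§3).
Mathlib + `AbcClassIIBasesPrep`; no new definitions.
-/

noncomputable section

open scoped BigOperators ComplexConjugate InnerProductSpace Matrix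
open Finset Matrix

namespace Summit.NavierStokesRegularity.FluidComputer.AbcClassII

open Literature.Analysis.FunctionSpaces Literature.Analysis.FunctionSpaces.Torus
open Literature.Analysis.FunctionSpaces.EuclideanSpace
open Literature.Analysis.FluidPDE Literature.Analysis.FluidPDE.SteadyLattice

/-! ## Part A2′. The end-to-end theorem in arbitrary orbit bases (instab4 g7) -/

section Bases

variable (e : ∀ O : Orbit, OrthonormalBasis (Fin (odim O)) ℝ (realSpace O.1))
variable (bf : Idx → Fam)
variable (hbf : ∀ i : Idx, bf i = extend i.1.1 ((e i.1 i.2 : realSpace i.1.1) : EuclideanSpace ℂ (↥i.1.1 × Fin 3)))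
variable (am : Idx → Idx → ℝ)
variable (ham : ∀ i j : Idx, am i j =
  (∑ k ∈ i.1.1, (inner ℂ (bf i k) (Torus.lerayCoeff k (crossForm 1 1 1 (bf j) k)) : ℂ)).re)

/-! ### §1 Conjugation of the section matrices by the orthogonal coefficient matrix -/

section
include hbf

/-- **`Q_Tᵀ Q_T = 1`** on an orbit-saturated index set `T`. -/
theorem coefQ_transpose_mul_self {T : Finset Idx} (hT : ∀ i ∈ T, ∀ a : Fin (odim i.1), (⟨i.1, a⟩ : Idx) ∈ T) :
    (Matrix.of fun i j : ↥T => (∑ k ∈ (i : Idx).1.1, (inner ℂ (bfam i k) (bf j k) : ℂ)).re)ᵀ *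
      (Matrix.of fun i j : ↥T => (∑ k ∈ (i : Idx).1.1, (inner ℂ (bfam i k) (bf j k) : ℂ)).re) = 1 := by
  ext j j'
  rw [Matrix.mul_apply, Matrix.one_apply]
  simp only [Matrix.transpose_apply, Matrix.of_apply]
  rw [Finset.sum_coe_sort T (fun i : Idx => (∑ k ∈ i.1.1, (inner ℂ (bfam i k) (bf j k) : ℂ)).re *
    (∑ k ∈ i.1.1, (inner ℂ (bfam i k) (bf j' k) : ℂ)).re), sum_coefQ_cols e bf hbf hT j.2 j'.2]
  by_cases h : j = j'
  · subst h; simp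
  · rw [if_neg h, if_neg fun h' => h (Subtype.ext h')]

/-- **`Q_T Q_Tᵀ = 1`** on an orbit-saturated index set `T`. -/
theorem coefQ_mul_transpose_self {T : Finset Idx} (hT : ∀ i ∈ T, ∀ a : Fin (odim i.1), (⟨i.1, a⟩ : Idx) ∈ T) :
    (Matrix.of fun i j : ↥T => (∑ k ∈ (i : Idx).1.1, (inner ℂ (bfam i k) (bf j k) : ℂ)).re) *
      (Matrix.of fun i j : ↥T => (∑ k ∈ (i : Idx).1.1, (inner ℂ (bfam i k) (bf j k) : ℂ)).re)ᵀ = 1 := by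
  ext i i'
  rw [Matrix.mul_apply, Matrix.one_apply]
  simp only [Matrix.transpose_apply, Matrix.of_apply]
  rw [Finset.sum_coe_sort T (fun j : Idx => (∑ k ∈ (i : Idx).1.1, (inner ℂ (bfam i k) (bf j k) : ℂ)).re *
    (∑ k ∈ (i' : Idx).1.1, (inner ℂ (bfam i' k) (bf j k) : ℂ)).re), sum_coefQ_rows e bf hbf hT i.2 i'.2]
  by_cases h : i = i'
  · subst h; simp
  · rw [if_neg h, if_neg fun h' => h (Subtype.ext h')]

/-- The coefficient kernel commutes with any orbitwise-constant diagonal: `κ_i Q i j = Q i j κ_j`. -/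
theorem coefQ_comm_diag (κ : Idx → ℝ) (hκ : ∀ i j : Idx, i.1 = j.1 → κ i = κ j) (i j : Idx) :
    κ i * (∑ k ∈ i.1.1, (inner ℂ (bfam i k) (bf j k) : ℂ)).re =
      (∑ k ∈ i.1.1, (inner ℂ (bfam i k) (bf j k) : ℂ)).re * κ j := by
  by_cases h : i.1 = j.1
  · rw [hκ i j h, mul_comm]
  · rw [coefQ_eq_zero_of_ne e bf hbf h, mul_zero, zero_mul]

include ham

/-- The first-order part: `Σ_{i' ∈ T₂} (Σ_{i ∈ T₁} Q i j · amat i i') · Q i' j' = am j j'`. -/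
theorem sum_sum_coefQ_amat {T₁ T₂ : Finset Idx} (hT₁ : ∀ i ∈ T₁, ∀ a : Fin (odim i.1), (⟨i.1, a⟩ : Idx) ∈ T₁)
    (hT₂ : ∀ i ∈ T₂, ∀ a : Fin (odim i.1), (⟨i.1, a⟩ : Idx) ∈ T₂) (j : ↥T₁) (j' : ↥T₂) :
    ∑ i' : ↥T₂, (∑ i : ↥T₁, (∑ k ∈ (i : Idx).1.1, (inner ℂ (bfam i k) (bf j k) : ℂ)).re * amat i i') *
      (∑ k ∈ (i' : Idx).1.1, (inner ℂ (bfam i' k) (bf j' k) : ℂ)).re = am j j' := by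
  rw [ham, eamat_eq_sum e bf hbf hT₁ hT₂ j.2 j'.2, Finset.sum_comm,
    ← Finset.sum_coe_sort T₂]
  refine Finset.sum_congr rfl fun i' _ => ?_
  rw [← Finset.sum_coe_sort T₁, Finset.sum_mul]

/-- **Conjugation of the SQUARE section matrix on a saturated index set**: `S'_T(x) = Q_Tᵀ S_T(x) Q_T`. -/
theorem section_conj_sq {T : Finset Idx} (hT : ∀ i ∈ T, ∀ a : Fin (odim i.1), (⟨i.1, a⟩ : Idx) ∈ T) (R x : ℝ) :
    (Matrix.of fun a b : ↥T => (if (a : Idx) = b then x + onormSq (b : Idx).1 / R else 0) - am a b) =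
      (Matrix.of fun i j : ↥T => (∑ k ∈ (i : Idx).1.1, (inner ℂ (bfam i k) (bf j k) : ℂ)).re)ᵀ *
        (Matrix.of fun a b : ↥T => (if (a : Idx) = b then x + onormSq (b : Idx).1 / R else 0) - amat a b) *
        (Matrix.of fun i j : ↥T => (∑ k ∈ (i : Idx).1.1, (inner ℂ (bfam i k) (bf j k) : ℂ)).re) := by
  have hone := coefQ_transpose_mul_self e bf hbf hT
  ext j j'
  have hone' := congrFun (congrFun hone j) j'
  rw [Matrix.mul_apply, Matrix.one_apply] at hone'
  simp only [Matrix.transpose_apply, Matrix.of_apply] at hone'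
  rw [Matrix.mul_apply]
  simp only [Matrix.mul_apply, Matrix.transpose_apply, Matrix.of_apply, mul_sub, Finset.sum_sub_distrib,
    sub_mul]
  congr 1
  · -- the diagonal part
    have hdiag : ∀ i' : ↥T, (∑ i : ↥T, (∑ k ∈ (i : Idx).1.1, (inner ℂ (bfam i k) (bf j k) : ℂ)).re *
        (if (i : Idx) = i' then x + onormSq (i' : Idx).1 / R else 0)) =
        (∑ k ∈ (i' : Idx).1.1, (inner ℂ (bfam i' k) (bf j k) : ℂ)).re * (x + onormSq (j : Idx).1 / R) := by
      intro i'
      rw [Finset.sum_eq_single i' (fun i _ hi => by rw [if_neg fun h => hi (Subtype.ext h), mul_zero])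
        (fun h => absurd (Finset.mem_univ _) h), if_pos rfl]
      have hc := coefQ_comm_diag e bf hbf (fun i => x + onormSq i.1 / R) (fun i j h => by simp only [h]) i' j
      linarith [hc]
    simp_rw [hdiag]
    rw [show ∑ i' : ↥T, (∑ k ∈ (i' : Idx).1.1, (inner ℂ (bfam i' k) (bf j k) : ℂ)).re * (x + onormSq (j : Idx).1 / R) *
        (∑ k ∈ (i' : Idx).1.1, (inner ℂ (bfam i' k) (bf j' k) : ℂ)).re =
        (x + onormSq (j : Idx).1 / R) * ∑ i' : ↥T, (∑ k ∈ (i' : Idx).1.1, (inner ℂ (bfam i' k) (bf j k) : ℂ)).re *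
          (∑ k ∈ (i' : Idx).1.1, (inner ℂ (bfam i' k) (bf j' k) : ℂ)).re by
      rw [Finset.mul_sum]; exact Finset.sum_congr rfl fun _ _ => by ring, hone']
    by_cases h : j = j'
    · subst h; simp
    · rw [if_neg h, if_neg fun h' => h (Subtype.ext h'), mul_zero]
  · exact (sum_sum_coefQ_amat e bf hbf am ham hT hT j j').symm

/-- **Conjugation of an OFF-DIAGONAL block between disjoint saturated index sets**:
`S'_{T₁T₂}(x) = Q_{T₁}ᵀ S_{T₁T₂}(x) Q_{T₂}` (the diagonal `if`s never fire). -/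
theorem section_conj_offdiag {T₁ T₂ : Finset Idx} (hT₁ : ∀ i ∈ T₁, ∀ a : Fin (odim i.1), (⟨i.1, a⟩ : Idx) ∈ T₁)
    (hT₂ : ∀ i ∈ T₂, ∀ a : Fin (odim i.1), (⟨i.1, a⟩ : Idx) ∈ T₂) (hdis : Disjoint T₁ T₂) (R x : ℝ) :
    (Matrix.of fun (a : ↥T₁) (b : ↥T₂) => (if (a : Idx) = b then x + onormSq (b : Idx).1 / R else 0) - am a b) =
      (Matrix.of fun i j : ↥T₁ => (∑ k ∈ (i : Idx).1.1, (inner ℂ (bfam i k) (bf j k) : ℂ)).re)ᵀ *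
        (Matrix.of fun (a : ↥T₁) (b : ↥T₂) => (if (a : Idx) = b then x + onormSq (b : Idx).1 / R else 0) - amat a b) *
        (Matrix.of fun i j : ↥T₂ => (∑ k ∈ (i : Idx).1.1, (inner ℂ (bfam i k) (bf j k) : ℂ)).re) := by
  have hne : ∀ (a : ↥T₁) (b : ↥T₂), (a : Idx) ≠ b := fun a b h =>
    Finset.disjoint_left.mp hdis a.2 (h ▸ b.2)
  ext j j'
  rw [Matrix.mul_apply]
  simp only [Matrix.mul_apply, Matrix.transpose_apply, Matrix.of_apply, if_neg (hne _ _), zero_sub, mul_neg,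
    Finset.sum_neg_distrib, neg_mul]
  rw [sum_sum_coefQ_amat e bf hbf am ham hT₁ hT₂ j j']

end

/-! ### §2 (T1) is basis-invariant: the head determinant sign product -/

/-- Sign bookkeeping: `(q d₁ q)(q d₂ q) < 0 ⇒ d₁ d₂ < 0`. -/
theorem det_sign_aux (q d₁ d₂ : ℝ) (h : q * d₁ * q * (q * d₂ * q) < 0) : d₁ * d₂ < 0 := by
  have e : q * d₁ * q * (q * d₂ * q) = d₁ * d₂ * (q * q * (q * q)) := by ring
  rw [e] at h
  exact neg_of_mul_neg_left h (mul_nonneg (mul_self_nonneg q) (mul_self_nonneg q))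

section
include hbf ham

/-- **(T1) transfers**: opposite head determinant signs in the bases `e` ⇒ the same in the basis `bfam`
(`det S'_H(x) = det Q_Hᵀ · det S_H(x) · det Q_H`). -/
theorem head_sign_transfer (R : ℝ) (K : ℕ) (x₁ x₂ : ℝ)
    (hdet : (Matrix.of fun a b : ↥(cubeIdx K) =>
        (if (a : Idx) = b then x₁ + onormSq (b : Idx).1 / R else 0) - am a b).det *
      (Matrix.of fun a b : ↥(cubeIdx K) =>
        (if (a : Idx) = b then x₂ + onormSq (b : Idx).1 / R else 0) - am a b).det < 0) :
    (Matrix.of fun a b : ↥(cubeIdx K) =>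
        (if (a : Idx) = b then x₁ + onormSq (b : Idx).1 / R else 0) - amat a b).det *
      (Matrix.of fun a b : ↥(cubeIdx K) =>
        (if (a : Idx) = b then x₂ + onormSq (b : Idx).1 / R else 0) - amat a b).det < 0 := by
  have hT : ∀ i ∈ cubeIdx K, ∀ a : Fin (odim i.1), (⟨i.1, a⟩ : Idx) ∈ cubeIdx K :=
    fun i hi a => cubeIdx_saturated K hi a
  have h₁ := congrArg Matrix.det (section_conj_sq e bf hbf am ham hT R x₁)
  have h₂ := congrArg Matrix.det (section_conj_sq e bf hbf am ham hT R x₂)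
  rw [Matrix.det_mul, Matrix.det_mul, Matrix.det_transpose] at h₁ h₂
  rw [h₁, h₂] at hdet
  exact det_sign_aux _ _ _ hdet

end

/-! ### §3 (T2) is basis-invariant: the shell Schur form -/

/-- Dot products are invariant under an orthogonal matrix: `(Qᵀ y) · (Qᵀ z) = y · z` if `Q Qᵀ = 1`. -/
theorem dotProduct_transpose_mulVec {n : Type*} [Fintype n] [DecidableEq n] (Q : Matrix n n ℝ)
    (hQ : Q * Qᵀ = 1) (y z : n → ℝ) : (Qᵀ *ᵥ y) ⬝ᵥ (Qᵀ *ᵥ z) = y ⬝ᵥ z := by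
  rw [Matrix.dotProduct_mulVec, Matrix.vecMul_transpose, Matrix.mulVec_mulVec, hQ, Matrix.one_mulVec]

/-- **The shell Schur form under a blockwise orthogonal change of basis** (abstract linear algebra):
with `Qh`, `Qs` orthogonal and a diagonal `Λ` commuting with `Qsᵀ`, the test
`μ|w|² ≤ wᵀΛw − s|w|² − wᵀ(C' A'⁻¹ B')w` for the conjugated blocks `A' = Qhᵀ A Qh`, `B' = Qhᵀ B Qs`,
`C' = Qsᵀ C Qh` (all `w`) implies the same test for `A, B, C` (substitute `w ↦ Qsᵀ w`). [folklore] -/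
theorem schur_form_transfer_abstract {m n : Type*} [Fintype m] [Fintype n] [DecidableEq m] [DecidableEq n]
    (A : Matrix m m ℝ) (B : Matrix m n ℝ) (C : Matrix n m ℝ) (Qh : Matrix m m ℝ) (Qs : Matrix n n ℝ)
    (hQh1 : Qhᵀ * Qh = 1) (hQh2 : Qh * Qhᵀ = 1) (hQs2 : Qs * Qsᵀ = 1)
    (lam : n → ℝ) (hlam : ∀ a b, lam a * Qs b a = Qs b a * lam b) (μ s : ℝ)
    (hX : ∀ w : n → ℝ, μ * (w ⬝ᵥ w) ≤ ∑ a, lam a * w a ^ 2 - s * (w ⬝ᵥ w) -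
      w ⬝ᵥ ((Qsᵀ * C * Qh * (Qhᵀ * A * Qh)⁻¹ * (Qhᵀ * B * Qs)) *ᵥ w)) :
    ∀ w : n → ℝ, μ * (w ⬝ᵥ w) ≤ ∑ a, lam a * w a ^ 2 - s * (w ⬝ᵥ w) - w ⬝ᵥ ((C * A⁻¹ * B) *ᵥ w) := by
  intro w
  -- the inverse of the conjugated head and the conjugated Schur product
  have hQhinv : Qh⁻¹ = Qhᵀ := Matrix.inv_eq_left_inv hQh1
  have hQhTinv : Qhᵀ⁻¹ = Qh := Matrix.inv_eq_left_inv hQh2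
  have hAinv : (Qhᵀ * A * Qh)⁻¹ = Qhᵀ * A⁻¹ * Qh := by
    rw [Matrix.mul_inv_rev, Matrix.mul_inv_rev, hQhinv, hQhTinv, Matrix.mul_assoc]
  have hcanc : ∀ X : Matrix m n ℝ, Qh * (Qhᵀ * X) = X := fun X => by
    rw [← Matrix.mul_assoc, hQh2, Matrix.one_mul]
  have hprod : Qsᵀ * C * Qh * (Qhᵀ * A * Qh)⁻¹ * (Qhᵀ * B * Qs) = Qsᵀ * (C * A⁻¹ * B) * Qs := by
    rw [hAinv]
    simp only [Matrix.mul_assoc, hcanc]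
  have key := hX (Qsᵀ *ᵥ w)
  rw [hprod] at key
  -- (i) the norm
  have e1 : (Qsᵀ *ᵥ w) ⬝ᵥ (Qsᵀ *ᵥ w) = w ⬝ᵥ w := dotProduct_transpose_mulVec Qs hQs2 w w
  -- (ii) the diagonal part
  have hdiag : ∀ v : n → ℝ, ∑ a, lam a * v a ^ 2 = v ⬝ᵥ (Matrix.diagonal lam *ᵥ v) := by
    intro v
    rw [dotProduct]
    refine Finset.sum_congr rfl fun a _ => ?_
    rw [Matrix.mulVec_diagonal]
    ring
  have hΛQ : Matrix.diagonal lam * Qsᵀ = Qsᵀ * Matrix.diagonal lam := by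
    ext a b
    rw [Matrix.diagonal_mul, Matrix.mul_diagonal, Matrix.transpose_apply]
    exact hlam a b
  have e2 : ∑ a, lam a * (Qsᵀ *ᵥ w) a ^ 2 = ∑ a, lam a * w a ^ 2 := by
    rw [hdiag, hdiag, Matrix.mulVec_mulVec, hΛQ, ← Matrix.mulVec_mulVec, dotProduct_transpose_mulVec Qs hQs2]
  -- (iii) the cross term
  have e3 : (Qsᵀ *ᵥ w) ⬝ᵥ ((Qsᵀ * (C * A⁻¹ * B) * Qs) *ᵥ (Qsᵀ *ᵥ w)) = w ⬝ᵥ ((C * A⁻¹ * B) *ᵥ w) := by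
    rw [Matrix.mulVec_mulVec, Matrix.mul_assoc _ Qs Qsᵀ, hQs2, Matrix.mul_one, ← Matrix.mulVec_mulVec,
      dotProduct_transpose_mulVec Qs hQs2]
  rw [e1, e2, e3] at key
  exact key

section
include hbf ham

/-- **(T2) transfers**: the shell Schur form bound in the bases `e` ⇒ the same bound in the basis
`bfam` (the head, head–shell and shell–head blocks are conjugated by the orthogonal coefficient matrices
of the head and of the shell, `section_conj_sq` / `section_conj_offdiag`; then
`schur_form_transfer_abstract`, the levels `|O|²/R` being constant on orbits). -/
theorem shell_form_transfer (R : ℝ) (K : ℕ) (x μ : ℝ)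
    (hX : ∀ w : ↥(cubeIdx (K + 1) \ cubeIdx K) → ℝ, μ * (w ⬝ᵥ w) ≤
      ∑ a : ↥(cubeIdx (K + 1) \ cubeIdx K), (x + onormSq (a : Idx).1 / R) * w a ^ 2 - Real.sqrt 2 * (w ⬝ᵥ w) -
        w ⬝ᵥ (((Matrix.of fun (a : ↥(cubeIdx (K + 1) \ cubeIdx K)) (b : ↥(cubeIdx K)) =>
            (if (a : Idx) = b then x + onormSq (b : Idx).1 / R else 0) - am a b) *
          (Matrix.of fun a b : ↥(cubeIdx K) =>
            (if (a : Idx) = b then x + onormSq (b : Idx).1 / R else 0) - am a b)⁻¹ *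
          (Matrix.of fun (a : ↥(cubeIdx K)) (b : ↥(cubeIdx (K + 1) \ cubeIdx K)) =>
            (if (a : Idx) = b then x + onormSq (b : Idx).1 / R else 0) - am a b)) *ᵥ w)) :
    ∀ w : ↥(cubeIdx (K + 1) \ cubeIdx K) → ℝ, μ * (w ⬝ᵥ w) ≤
      ∑ a : ↥(cubeIdx (K + 1) \ cubeIdx K), (x + onormSq (a : Idx).1 / R) * w a ^ 2 - Real.sqrt 2 * (w ⬝ᵥ w) -
        w ⬝ᵥ (((Matrix.of fun (a : ↥(cubeIdx (K + 1) \ cubeIdx K)) (b : ↥(cubeIdx K)) =>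
            (if (a : Idx) = b then x + onormSq (b : Idx).1 / R else 0) - amat a b) *
          (Matrix.of fun a b : ↥(cubeIdx K) =>
            (if (a : Idx) = b then x + onormSq (b : Idx).1 / R else 0) - amat a b)⁻¹ *
          (Matrix.of fun (a : ↥(cubeIdx K)) (b : ↥(cubeIdx (K + 1) \ cubeIdx K)) =>
            (if (a : Idx) = b then x + onormSq (b : Idx).1 / R else 0) - amat a b)) *ᵥ w) := by
  -- saturation, disjointness
  have hTh : ∀ i ∈ cubeIdx K, ∀ a : Fin (odim i.1), (⟨i.1, a⟩ : Idx) ∈ cubeIdx K :=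
    fun i hi a => cubeIdx_saturated K hi a
  have hTs : ∀ i ∈ cubeIdx (K + 1) \ cubeIdx K, ∀ a : Fin (odim i.1),
      (⟨i.1, a⟩ : Idx) ∈ cubeIdx (K + 1) \ cubeIdx K :=
    fun i hi a => shellIdx_saturated (K + 1) K hi a
  have hdis₁ : Disjoint (cubeIdx (K + 1) \ cubeIdx K) (cubeIdx K) := Finset.sdiff_disjoint
  have hdis₂ : Disjoint (cubeIdx K) (cubeIdx (K + 1) \ cubeIdx K) := Finset.disjoint_sdiff
  -- the abstract transfer with the orthogonal coefficient matrices of head and shell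
  refine schur_form_transfer_abstract _ _ _
    (Matrix.of fun i j : ↥(cubeIdx K) => (∑ k ∈ (i : Idx).1.1, (inner ℂ (bfam i k) (bf j k) : ℂ)).re)
    (Matrix.of fun i j : ↥(cubeIdx (K + 1) \ cubeIdx K) =>
      (∑ k ∈ (i : Idx).1.1, (inner ℂ (bfam i k) (bf j k) : ℂ)).re)
    (coefQ_transpose_mul_self e bf hbf hTh) (coefQ_mul_transpose_self e bf hbf hTh)
    (coefQ_mul_transpose_self e bf hbf hTs) (fun a => x + onormSq (a : Idx).1 / R) (fun a b => ?_)
    μ (Real.sqrt 2) (fun w => ?_)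
  · -- the levels are constant on orbits
    rw [Matrix.of_apply]
    have h := coefQ_comm_diag e bf hbf (fun i => x + onormSq i.1 / R) (fun i j h => by simp only [h]) b a
    linarith [h]
  · rw [← section_conj_sq e bf hbf am ham hTh R x, ← section_conj_offdiag e bf hbf am ham hTh hTs hdis₂ R x,
      ← section_conj_offdiag e bf hbf am ham hTs hTh hdis₁ R x]
    exact hX w

end

/-! ### §4 END-TO-END from the certificate's three numbers in ARBITRARY orbit bases -/

section
include hbf ham

/-- **END-TO-END FROM THE CERTIFICATE'S THREE NUMBERS, IN ARBITRARY ORTHONORMAL ORBIT BASES (closed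
bracket).** MODEL operator `L_R = −(1/R)|k|² + ΠX` about `abcFlow 1 1 1`, class II. Let `e O` be ANY
family of real orthonormal bases of the class-II orbit spaces `realSpace O` indexed by `Fin (odim O)`,
`bf i = extend O_i (e O_i i.2)` its basis families and `am i j = Re Σ_{k∈O_i} ⟪bf i k, Π_k X(bf j)(k)⟫` its
real first-order matrix; section matrix entries `S_x(i,j) = (x + |O_j|²/R)δ_ij − am i j`. Let `K : ℕ`,
`x₁ < x₂`, `R ≥ 1`, and at both ends `x = x₁, x₂`:
(T1) the HEAD matrices `[S_x]` on `cubeIdx K` have determinants of opposite signs;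
(T2) SHELL numbers `μ_x > 0`: `μ_x‖w‖² ≤ Σ_a (x + |O_a|²/R) w_a² − √2‖w‖² − w·(C_x A_x⁻¹ B_x) w` for every
     real `w` on the shell `cubeIdx (K+1) ∖ cubeIdx K`;
(T3) TAIL constants `μ_x ≤ x + (K+2)²/R − √2`.
Then `∃ λ ∈ [x₁, x₂]`, `Torus.IsLinNSEigenvalue (1/(2πR)) (Torus.abcFlow 1 1 1) (2πλ)`.
(T1)/(T2) are transferred to the existential basis `bfam` by `head_sign_transfer` / `shell_form_transfer`
and `AbcClassIISections.isLinNSEigenvalue_of_certificate` concludes. What a CERTIFIER AUDIT must check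
of the certifier's basis to use this theorem: on every orbit of the cube `K+1` its vectors are
transversal, class II, conjugate-symmetric, real-orthonormal, and `odim O` in number. -/
theorem isLinNSEigenvalue_of_certificate_of_bases {R : ℝ} (hR : 1 ≤ R) (K : ℕ) {x₁ x₂ : ℝ} (hlt : x₁ < x₂)
    (μ₁ μ₂ : ℝ) (hμ₁ : 0 < μ₁) (hμ₂ : 0 < μ₂)
    (hq₁ : μ₁ ≤ x₁ + ((K : ℝ) + 2) ^ 2 / R - Real.sqrt 2) (hq₂ : μ₂ ≤ x₂ + ((K : ℝ) + 2) ^ 2 / R - Real.sqrt 2)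
    (hdet : (Matrix.of fun a b : ↥(cubeIdx K) =>
        (if (a : Idx) = b then x₁ + onormSq (b : Idx).1 / R else 0) - am a b).det *
      (Matrix.of fun a b : ↥(cubeIdx K) =>
        (if (a : Idx) = b then x₂ + onormSq (b : Idx).1 / R else 0) - am a b).det < 0)
    (hX₁ : ∀ w : ↥(cubeIdx (K + 1) \ cubeIdx K) → ℝ, μ₁ * (w ⬝ᵥ w) ≤
      ∑ a : ↥(cubeIdx (K + 1) \ cubeIdx K), (x₁ + onormSq (a : Idx).1 / R) * w a ^ 2 - Real.sqrt 2 * (w ⬝ᵥ w) -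
        w ⬝ᵥ (((Matrix.of fun (a : ↥(cubeIdx (K + 1) \ cubeIdx K)) (b : ↥(cubeIdx K)) =>
            (if (a : Idx) = b then x₁ + onormSq (b : Idx).1 / R else 0) - am a b) *
          (Matrix.of fun a b : ↥(cubeIdx K) =>
            (if (a : Idx) = b then x₁ + onormSq (b : Idx).1 / R else 0) - am a b)⁻¹ *
          (Matrix.of fun (a : ↥(cubeIdx K)) (b : ↥(cubeIdx (K + 1) \ cubeIdx K)) =>
            (if (a : Idx) = b then x₁ + onormSq (b : Idx).1 / R else 0) - am a b)) *ᵥ w))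
    (hX₂ : ∀ w : ↥(cubeIdx (K + 1) \ cubeIdx K) → ℝ, μ₂ * (w ⬝ᵥ w) ≤
      ∑ a : ↥(cubeIdx (K + 1) \ cubeIdx K), (x₂ + onormSq (a : Idx).1 / R) * w a ^ 2 - Real.sqrt 2 * (w ⬝ᵥ w) -
        w ⬝ᵥ (((Matrix.of fun (a : ↥(cubeIdx (K + 1) \ cubeIdx K)) (b : ↥(cubeIdx K)) =>
            (if (a : Idx) = b then x₂ + onormSq (b : Idx).1 / R else 0) - am a b) *
          (Matrix.of fun a b : ↥(cubeIdx K) =>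
            (if (a : Idx) = b then x₂ + onormSq (b : Idx).1 / R else 0) - am a b)⁻¹ *
          (Matrix.of fun (a : ↥(cubeIdx K)) (b : ↥(cubeIdx (K + 1) \ cubeIdx K)) =>
            (if (a : Idx) = b then x₂ + onormSq (b : Idx).1 / R else 0) - am a b)) *ᵥ w)) :
    ∃ lam ∈ Set.Icc x₁ x₂,
      Torus.IsLinNSEigenvalue (1 / (2 * Real.pi * R)) (Torus.abcFlow 1 1 1) ((2 * Real.pi * lam : ℝ) : ℂ) :=
  isLinNSEigenvalue_of_certificate hR K hlt μ₁ μ₂ hμ₁ hμ₂ hq₁ hq₂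
    (head_sign_transfer e bf hbf am ham R K x₁ x₂ hdet)
    (shell_form_transfer e bf hbf am ham R K x₁ μ₁ hX₁)
    (shell_form_transfer e bf hbf am ham R K x₂ μ₂ hX₂)

end

end Bases

end Summit.NavierStokesRegularity.FluidComputer.AbcClassII

end
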